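import Mathlib
import HarnessLib
import Summits.Parity.GeneralizedHardyLittlewood.Theses.LeeYangFibres
import Summits.Parity.GeneralizedHardyLittlewood.Theorems.LeeYangFibresFibreHyperbolicityDefs
import Summits.Parity.GeneralizedHardyLittlewood.Theorems.LeeYangFibresFibreHyperbolicityGhostFree
import Summits.Parity.GeneralizedHardyLittlewood.Theorems.LeeYangFibresCellParityLawBase

/-!
# Crux `FibreHyperbolicity` (stmt-Parity-14108), line "model transfer": the ghost-free cell law for ONE form

`GhostFreeCellLaw t` (file `…FibreHyperbolicityGhostFree`) is the route's `CellParityLaw` inequality with the Walsh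
amplitude replaced by `1`. Its `t = 1` case is parity-free and is PROVED here, unconditionally and with no mass
hypothesis on `K`: it is the Landau–Alladi law for the rough `Ω`-cells of one progression segment, which the
`CellParityLaw` line `section-annihilator` landed as `SectionAnnihilator.BaseAux.cell_law` (effective error
`N / (log N · (log log N)^B)`; Alladi's asymptotic in reduced classes + the tree's Bombieri–Vinogradov input +
the Green–Tao normalisations `β_∞ = |K ∩ {ψ > 0}|`, `𝔖 = 𝟙_{(a,b)=1}|a|/φ(|a|)`). We take `B = 1` and
`N ≥ exp exp (1/ε)`.

With `stub_ghostFreeOne` (registered stub of skeleton v6) the family `GhostFreeCellLaw t`, `t ≥ 1`, is reduced to its `t ≥ 2` members — the one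
open stub `stub_ghostFree` of the skeleton `Cruxes/FibreHyperbolicity/Lines/SketchIdeator1.lean`; the companion
file `…FibreHyperbolicityResidue` shows that this stub implies not only the crux but the route's cell-parity law,
its cell-level output `PrimeCellsRelative` and its `d = 1` output `RelativeDimOne`.
-/

noncomputable section

namespace Summit.Parity.GeneralizedHardyLittlewood.Cruxes.FibreHyperbolicity.ModelTransfer

open scoped BigOperators Classical
open Finset
open Literature.NumberTheory.Sieve
open Summit.Parity.GeneralizedHardyLittlewood.Cruxes.CellParityLaw.SectionAnnihilator (cell)

/-- The `CellParityLaw` line's cell count `SectionAnnihilator.cell` and this line's `jointCell` are the same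
number (both are verbatim the crux's filtered cardinality). -/
theorem cell_eq_jointCell {t : ℕ} (Ψ : Fin t → AffLinForm 1) (K : Set (Fin 1 → ℝ)) (N u : ℕ)
    (j : Fin t → ℕ) : cell Ψ K N u j = jointCell t N u Ψ K j := rfl

/-- No non-degenerate one-dimensional system has size `affLinSize Ψ N ≤ 0`. -/
theorem not_isNondegenerate_of_affLinSize_le_zero {t : ℕ} {Ψ : Fin t → AffLinForm 1} {N : ℕ}
    (hΨ : IsNondegenerateSystem Ψ) (hsize : affLinSize Ψ N ≤ (0 : ℕ)) (i : Fin t) : False := by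
  apply hΨ.1 i
  have h : affLinSize Ψ N ≤ 0 := by exact_mod_cast hsize
  unfold affLinSize at h
  have hA : 0 ≤ ∑ k, ∑ l, |(((Ψ k).coeff l : ℤ) : ℝ)| :=
    Finset.sum_nonneg fun _ _ => Finset.sum_nonneg fun _ _ => abs_nonneg _
  have hB : 0 ≤ ∑ k, |(((Ψ k).const : ℤ) : ℝ) / N| := Finset.sum_nonneg fun _ _ => abs_nonneg _
  have hA0 : ∑ k, ∑ l, |(((Ψ k).coeff l : ℤ) : ℝ)| = 0 := by linarith
  have hi := (Finset.sum_eq_zero_iff_of_nonneg (fun k _ => Finset.sum_nonneg fun _ _ => abs_nonneg _)).mp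
    hA0 i (Finset.mem_univ i)
  funext l
  have hl := (Finset.sum_eq_zero_iff_of_nonneg (fun l _ => abs_nonneg _)).mp hi l (Finset.mem_univ l)
  exact_mod_cast abs_eq_zero.mp hl

/-- **The ghost-free cell law for one form** (`GhostFreeCellLaw 1`), unconditional and parity-free: for every
`L`, `u ≥ 2`, `ε > 0` and `N ≥ N₀`, every non-degenerate form `a n + b` with `|a| + |b|/N ≤ L`, every convex
`K ⊆ [-N, N]` and every `1 ≤ j ≤ u`,
`|#{n ∈ K ∩ ℤ : P⁻(an+b) > N^{1/u}, Ω(an+b) = j} − β_∞ 𝔖 A_j(N)/N| ≤ ε N / log N`.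
From `SectionAnnihilator.BaseAux.cell_law` at `B = 1`, since `1/log log N ≤ ε` once `N ≥ exp exp (1/ε)`. -/
theorem stub_ghostFreeOne : GhostFreeCellLaw 1 := by
  intro L u hu ε hε
  rcases Nat.lt_or_ge L 1 with hL | hL
  · refine ⟨0, fun N _ Ψ hΨ hsize K _ _ j _ => ?_⟩
    exact (not_isNondegenerate_of_affLinSize_le_zero hΨ (by simpa [Nat.lt_one_iff.mp hL] using hsize) 0).elim
  obtain ⟨N₀, hN₀⟩ :=
    Summit.Parity.GeneralizedHardyLittlewood.Cruxes.CellParityLaw.SectionAnnihilator.BaseAux.cell_law L u 1 hu hL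
  refine ⟨max N₀ ⌈Real.exp (Real.exp (1 / ε))⌉₊, fun N hN Ψ hΨ hsize K hK hKN j hj => ?_⟩
  have hN₀N : N₀ ≤ N := le_trans (le_max_left _ _) hN
  have hN₁N : (⌈Real.exp (Real.exp (1 / ε))⌉₊ : ℝ) ≤ N := by
    exact_mod_cast le_trans (le_max_right _ _) hN
  have hexpN : Real.exp (Real.exp (1 / ε)) ≤ (N : ℝ) := le_trans (Nat.le_ceil _) hN₁N
  have hlogN : Real.exp (1 / ε) ≤ Real.log N := by
    have := Real.log_le_log (Real.exp_pos _) hexpN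
    rwa [Real.log_exp] at this
  have hloglogN : 1 / ε ≤ Real.log (Real.log N) := by
    have := Real.log_le_log (Real.exp_pos _) hlogN
    rwa [Real.log_exp] at this
  have hε' : 0 < 1 / ε := by positivity
  have hlogpos : 0 < Real.log N := lt_of_lt_of_le (Real.exp_pos _) hlogN
  have hllpos : 0 < Real.log (Real.log N) := lt_of_lt_of_le hε' hloglogN
  have hinv : 1 / Real.log (Real.log N) ≤ ε := (one_div_le hllpos hε).mpr hloglogN
  have hNn : 0 ≤ (N : ℝ) / Real.log N := div_nonneg (Nat.cast_nonneg N) hlogpos.le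
  -- the base law at the cell index `j 0`
  have key := hN₀ N hN₀N Ψ hΨ hsize K hK hKN (j 0) (hj 0).1 (hj 0).2
  have e : (fun _ : Fin 1 => j 0) = j := by funext k; rw [Fin.fin_one_eq_zero k]
  rw [e, cell_eq_jointCell] at key
  rw [Fin.prod_univ_one, pow_one]
  refine key.trans ?_
  calc (N : ℝ) / (Real.log N * Real.log (Real.log N) ^ 1)
      = (N : ℝ) / Real.log N * (1 / Real.log (Real.log N)) := by
        rw [pow_one, div_mul_eq_div_div, div_eq_mul_one_div ((N : ℝ) / Real.log N)]
    _ ≤ (N : ℝ) / Real.log N * ε := mul_le_mul_of_nonneg_left hinv hNn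
    _ = ε * N / Real.log N := by ring

end Summit.Parity.GeneralizedHardyLittlewood.Cruxes.FibreHyperbolicity.ModelTransfer

end
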